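import Summits.QuantumFields.BalabanUV.T4Continuum.Support.NE3CovariantLineAdjointFrame
import Summits.QuantumFields.BalabanUV.T4Continuum.Support.NE3StraightAverageSplit
import Summits.QuantumFields.BalabanUV.T4Continuum.Support.NE3EnergyHessBilin
import HarnessLib

/-!
# T⁴ programme, node NE3 — route H♮ row K4, file K4-b: THE COVARIANT SPLIT OF THE ADJOINT, EXACT AT ANY UNITARY BACKGROUND —
# `WadWg M (combFrame W M) ω = D^W_κ hspW + JmpW` with `RemW ≡ 0` ((70S) `Wad_eq` with the κ-last comb transports inserted)

NE3 formalisation swarm `b2b-balaban-t4-ne3-formalise-*`, LEAF PROVER 03 (unit `b2b-balaban-t4-ne3-formalise-leaf-03`, gen 7; cell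
`pub-balaban`); row **K4** of ruling ρ-g22-2 (journal l.17514), item K4-b as RULED in ρ-g22-3 (l.18000: «K4-b exact at ANY unitary W,
RemW ≡ 0») and NE3-R2 g7's D-ne3r2-g7-3 «RESOLVED BY CONSTRUCTION in K4-a» (l.18238); CLAIM journal l.18305.  On K4-a `NE3CovariantLineAdjoint`
(p228505: `WadWg`, `WadWg_eq`, `combTransport_succ`) + `NE3CovariantLineAdjointFrame` (p228795: `combFrame`, `TWc`).

MECHANISM.  With the κ-LAST comb, ALL copies through one fine bond `(x, κ)` that started in the block `z = cdiv M x` share ONE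
transport — the inverse holonomy from the corner `M•z` along `treeWord(r^⊥) ++ seg κ (r_κ + 1)`, `r = cmod M x` — and the copies
from the previous block `z − e_κ` share another (`seg κ (M + r_κ + 1)` from `M•(z − e_κ)`).  Both transports obey the STEP LAW
`P(x + e_κ) = W(x + e_κ, κ)⁻¹ · P(x)` (one more bond), so (70S)'s scalar residue algebra `Wad = hsp(·+e_κ) − hsp + Jmp` transports
VERBATIM: the covariant difference `Ad (W (x+e_κ) κ) (hspW (x+e_κ)) − hspW x` reproduces the weights' discrete derivative with NO
remainder, and the only face term is (70S)'s jump `M²•ω(z)`, transported.  No smallness, no gauge fixing.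

CONTENT (all [folklore]; 0 sorry; 0 `def … : Prop`; DATA defs `cornerToBond`, `hspW`, `JmpW`):
§1 `cornerToBond W M z x κ := (hol W (M•z) (treeWord ((x − M•z) − (x − M•z)_κ•e_κ) ++ seg κ ((x − M•z)_κ + 1)))⁻¹`, `combFrame_eq_cornerToBond`,
   THE STEP LAW `cornerToBond_add_e`, unitarity;
§2 THE CLOSED FORM `WadWg_combFrame_eq`: `WadWg M (combFrame W M) ω x κ = (r_κ+1)•Ad (cornerToBond W M z x κ) (ω z κ)
   + (M−1−r_κ)•Ad (cornerToBond W M (z−e_κ) x κ) (ω (z−e_κ) κ)`;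
§3 `hspW`, `JmpW` and **THE SPLIT `WadWg_combFrame_eq_split`**: `WadWg M (combFrame W M) ω x κ = Ad (W (x+e_κ) κ) (hspW M W ω (x+e_κ) κ) − hspW M W ω x κ
   + JmpW M W ω x κ` for EVERY units-valued `W`, and its `cD` form **`WadWg_combFrame_eq_cD_add_JmpW`** (`cD` of leaf-03-g6's `NE3CovariantCalculus`
   at the shifted configuration `y μ ↦ W (y + e_κ) μ`, so that `sum_hsR_cD` is the covariant summation by parts);
§4 bounds `norm_hspW_le` (`≤ (M²∕2)(‖ω z κ‖ + ‖ω (z−e_κ) κ‖)`, unitary `W`), `norm_JmpW_le` (`≤ M²‖ω z κ‖`), `JmpW_of_ne` (vanishes off faces);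
§5 flat checks `hspW_flatCfg = hsp`, `JmpW_flatCfg = Jmp`.

HONEST FRAMING.  Exact lattice bookkeeping at a GENERAL unitary background on OUR typed objects; no estimate; nothing about Bałaban's
minimisers; (P♮)_W, (ML_w) at W ≠ 1, T-E_w and NE3 are NOT proved; spine PROVED 0∕9; finite T⁴ rung (B)+1 — NOT infinite volume, NOT mass gap,
NOT BetaPertH, NOT Clay.  ABSOLUTE RULE kept (context only: [Balaban1985Averaging] (42) p. 23, p. 24, p. 28).  PLACEMENT:
`Summits/QuantumFields/BalabanUV/`; imports the accepted K4-a files, (70S) and leaf-03-g3's `NE3EnergyHessBilin` (`Ad_real_smul`) only.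
-/

set_option autoImplicit false

open scoped BigOperators Matrix.Norms.L2Operator
open Finset

namespace Summit.QuantumFields.BalabanUV.T4Continuum.NE3CovariantLineAdjoint

open Literature.MathematicalPhysics.QuantumFieldTheory.Balaban1983to89
open B7Prop1Explicit B7Prop2Explicit
open T4AveragingDeficitWall (IsUnitaryCfg Ad)
open T4AveragingDeficitWallBoundary (periodBox mem_periodBox)
open T4AveragingDeficitNonAbelian (Ad_mul Ad_sub)
open AveragingDeficitNearIdentity (Ad_one)
open AveragingDeficitTransport (norm_Ad_of_unitary)
open MinimalActionWitness (flatCfg)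
open NE3StraightAverageAdjoint (Wad cdiv_cmod_block cdiv_add_e_of_ne cmod_add_e_of_ne cdiv_add_e_of_eq cmod_add_e_of_eq)
open NE3StraightAverageSplit (αw γw hsp Jmp αw_nonneg_le γw_nonneg_le)
open NE3CovariantCalculus (hsR cD)
open NE3EnergyHessBilin (Ad_real_smul)
open SkeletonLattice (cdiv cmod smul_cdiv_add_cmod cmod_nonneg cmod_lt)

noncomputable section

variable {d : ℕ} {n : Type*} [Fintype n] [DecidableEq n]

/-! ## §1 The transport from a block corner to the frame of a fine bond along the `κ`-last comb -/

/-- THE CORNER-TO-BOND TRANSPORT: `cornerToBond W M z x κ = (W(M•z; treeWord(w^⊥) ++ seg κ (w_κ + 1)))⁻¹`, `w = x − M•z` — the inverse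
holonomy from the corner of block `z` along the transverse tree of `w` and then the `κ`-line up to and including the bond `(x, κ)`; `Ad`
of it carries a corner value to the frame of that bond (defined for every `x`; used for `x` in block `z` and on the continued `κ`-line).
[folklore] -/
def cornerToBond (W : Site d → Fin d → (Matrix n n ℂ)ˣ) (M : ℕ) (z x : Site d) (κ : Fin d) : (Matrix n n ℂ)ˣ :=
  (hol W ((M : ℤ) • z) (treeWord ((x - (M : ℤ) • z) - (x - (M : ℤ) • z) κ • e κ) ++ seg κ ((x - (M : ℤ) • z) κ + 1)))⁻¹

omit [Fintype n] [DecidableEq n] in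
/-- Transverse part and `κ`-coordinate of `v + i•e_κ`. [folklore] -/
theorem transverse_add_smul_e (v : Site d) (κ : Fin d) (i : ℤ) :
    (v + i • e κ) - (v + i • e κ) κ • e κ = v - v κ • e κ ∧ (v + i • e κ) κ = v κ + i := by
  constructor
  · funext j
    by_cases hj : j = κ
    · subst hj; simp [e_apply]
    · simp [e_apply, hj]
  · simp [e_apply]

/-- **ALL COPIES THROUGH ONE BOND FROM ONE BLOCK SHARE ONE TRANSPORT**: `combFrame W M z κ v i = cornerToBond W M z (M•z + v + i•e_κ) κ`.
[folklore] -/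
theorem combFrame_eq_cornerToBond (W : Site d → Fin d → (Matrix n n ℂ)ˣ) (M : ℕ) (z : Site d) (κ : Fin d) (v : Site d) (i : ℕ) :
    combFrame W M z κ v i = cornerToBond W M z ((M : ℤ) • z + v + (i : ℤ) • e κ) κ := by
  unfold combFrame combTransport klastWord cornerToBond
  have hw : (M : ℤ) • z + v + (i : ℤ) • e κ - (M : ℤ) • z = v + (i : ℤ) • e κ := by abel
  obtain ⟨h1, h2⟩ := transverse_add_smul_e v κ (i : ℤ)
  rw [hw, h1, h2]
  push_cast
  ring_nf

/-- **THE STEP LAW** (one more bond along `κ`): `cornerToBond W M z (x + e_κ) κ = (W (x + e_κ) κ)⁻¹ * cornerToBond W M z x κ`. [folklore] -/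
theorem cornerToBond_add_e (W : Site d → Fin d → (Matrix n n ℂ)ˣ) (M : ℕ) (z x : Site d) (κ : Fin d) :
    cornerToBond W M z (x + e κ) κ = (W (x + e κ) κ)⁻¹ * cornerToBond W M z x κ := by
  unfold cornerToBond
  set w : Site d := x - (M : ℤ) • z with hw
  have hw' : x + e κ - (M : ℤ) • z = w + (1 : ℤ) • e κ := by rw [hw, one_smul]; abel
  obtain ⟨h1, h2⟩ := transverse_add_smul_e w κ 1
  rw [hw', h1, h2, hol_append, hol_append, hol_seg_succ, disp_treeWord, mul_inv_rev, mul_inv_rev, mul_inv_rev, mul_assoc]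
  congr 2
  have : (M : ℤ) • z + (w - w κ • e κ) + (w κ + 1) • e κ = x + e κ := by
    rw [add_smul, one_smul, hw]
    have : x - (M : ℤ) • z - (x - (M : ℤ) • z) κ • e κ + (x - (M : ℤ) • z) κ • e κ = x - (M : ℤ) • z := by abel
    rw [← add_assoc, add_assoc ((M : ℤ) • z), this]; abel
  rw [this]

/-- The corner-to-bond transports of `U(N)` data are unitary. [folklore] -/
theorem cornerToBond_mem {W : Site d → Fin d → (Matrix n n ℂ)ˣ} (hW : IsUnitaryCfg W) (M : ℕ) (z x : Site d) (κ : Fin d) :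
    cornerToBond W M z x κ ∈ unitaryUnits (Matrix n n ℂ) :=
  (unitaryUnits (Matrix n n ℂ)).inv_mem (hol_mem_of hW _ _)

/-! ## §2 The closed form of the adjoint for the comb frames -/

section Closed

variable {M : ℕ}

/-- **THE CLOSED FORM**: with `z = cdiv M x`, `r = cmod M x`,
`WadWg M (combFrame W M) ω x κ = (r_κ + 1)•Ad (cornerToBond W M z x κ) (ω z κ) + (M − 1 − r_κ)•Ad (cornerToBond W M (z − e_κ) x κ) (ω (z − e_κ) κ)`
(real scalars). [folklore] -/
theorem WadWg_combFrame_eq (hM : 1 ≤ M) (W : Site d → Fin d → (Matrix n n ℂ)ˣ) (ω : Site d → Fin d → Matrix n n ℂ) (x : Site d) (κ : Fin d) :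
    WadWg M (combFrame W M) ω x κ
      = (((cmod M x κ : ℤ) : ℝ) + 1) • Ad (cornerToBond W M (cdiv M x) x κ) (ω (cdiv M x) κ)
        + ((M : ℝ) - 1 - ((cmod M x κ : ℤ) : ℝ)) • Ad (cornerToBond W M (cdiv M x - e κ) x κ) (ω (cdiv M x - e κ) κ) := by
  rw [WadWg_eq hM]
  have hx : (M : ℤ) • cdiv M x + cmod M x = x := smul_cdiv_add_cmod M x
  have hA : ∀ i ∈ (range M).filter (fun i : ℕ => (i : ℤ) ≤ cmod M x κ),
      Ad (combFrame W M (cdiv M x) κ (cmod M x - (i : ℤ) • e κ) i) (ω (cdiv M x) κ)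
        = Ad (cornerToBond W M (cdiv M x) x κ) (ω (cdiv M x) κ) := by
    intro i _
    rw [combFrame_eq_cornerToBond]
    congr 2
    conv_rhs => rw [← hx]
    abel
  have hB : ∀ i ∈ (range M).filter (fun i : ℕ => cmod M x κ < (i : ℤ)),
      Ad (combFrame W M (cdiv M x - e κ) κ (cmod M x - (i : ℤ) • e κ + (M : ℤ) • e κ) i) (ω (cdiv M x - e κ) κ)
        = Ad (cornerToBond W M (cdiv M x - e κ) x κ) (ω (cdiv M x - e κ) κ) := by
    intro i _
    rw [combFrame_eq_cornerToBond]
    congr 2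
    conv_rhs => rw [← hx]
    rw [smul_sub]; abel
  rw [sum_congr rfl hA, sum_congr rfl hB, sum_const, sum_const, ← Nat.cast_smul_eq_nsmul ℝ, ← Nat.cast_smul_eq_nsmul ℝ,
    card_filter_le_cmod hM, card_filter_cmod_lt hM]

end Closed

/-! ## §3 The covariant spline correction, the face jump, and THE SPLIT -/

/-- **THE COVARIANT SPLINE CORRECTION** `hspW M W ω x κ := α(r_κ)•Ad(P_z(x)) (ω z κ) − γ_M(r_κ)•Ad(P_{z−e_κ}(x)) (ω (z − e_κ) κ)`
(`P = cornerToBond`, `z = cdiv M x`, `r = cmod M x`; (70S)'s `hsp` with the comb transports inserted). [folklore] -/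
def hspW (M : ℕ) (W : Site d → Fin d → (Matrix n n ℂ)ˣ) (ω : Site d → Fin d → Matrix n n ℂ) (x : Site d) (κ : Fin d) : Matrix n n ℂ :=
  αw ((cmod M x κ : ℤ) : ℝ) • Ad (cornerToBond W M (cdiv M x) x κ) (ω (cdiv M x) κ)
    - γw M ((cmod M x κ : ℤ) : ℝ) • Ad (cornerToBond W M (cdiv M x - e κ) x κ) (ω (cdiv M x - e κ) κ)

/-- **THE COVARIANT FACE JUMP** `JmpW M W ω x κ := [r_κ(x) = M − 1]·M²•Ad(P_z(x)) (ω z κ)`. [folklore] -/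
def JmpW (M : ℕ) (W : Site d → Fin d → (Matrix n n ℂ)ˣ) (ω : Site d → Fin d → Matrix n n ℂ) (x : Site d) (κ : Fin d) : Matrix n n ℂ :=
  if cmod M x κ = (M : ℤ) - 1 then ((M : ℝ) ^ 2) • Ad (cornerToBond W M (cdiv M x) x κ) (ω (cdiv M x) κ) else 0

section Split

variable {M : ℕ}

/-- Off the faces the jump vanishes. [folklore] -/
theorem JmpW_of_ne (W : Site d → Fin d → (Matrix n n ℂ)ˣ) (ω : Site d → Fin d → Matrix n n ℂ) {x : Site d} {κ : Fin d}
    (h : cmod M x κ ≠ (M : ℤ) - 1) : JmpW M W ω x κ = 0 := by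
  simp [JmpW, h]

/-- **THE SPLIT, EXACT AT ANY BACKGROUND**: for every units-valued `W` (no unitarity, no smallness needed),
`WadWg M (combFrame W M) ω x κ = Ad (W (x+e_κ) κ) (hspW M W ω (x+e_κ) κ) − hspW M W ω x κ + JmpW M W ω x κ`. [folklore] -/
theorem WadWg_combFrame_eq_split (hM : 1 ≤ M) (W : Site d → Fin d → (Matrix n n ℂ)ˣ) (ω : Site d → Fin d → Matrix n n ℂ)
    (x : Site d) (κ : Fin d) :
    WadWg M (combFrame W M) ω x κ
      = Ad (W (x + e κ) κ) (hspW M W ω (x + e κ) κ) - hspW M W ω x κ + JmpW M W ω x κ := by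
  rw [WadWg_combFrame_eq hM]
  -- the step law for both source blocks, in `Ad` form
  have hstepA : ∀ (z : Site d) (X : Matrix n n ℂ),
      Ad (W (x + e κ) κ) (Ad (cornerToBond W M z (x + e κ) κ) X) = Ad (cornerToBond W M z x κ) X := by
    intro z X
    rw [← Ad_mul, cornerToBond_add_e, ← mul_assoc, mul_inv_cancel, one_mul]
  -- push the bond transport through the spline correction at `x + e_κ`
  have hpush : Ad (W (x + e κ) κ) (hspW M W ω (x + e κ) κ)
      = αw ((cmod M (x + e κ) κ : ℤ) : ℝ) • Ad (cornerToBond W M (cdiv M (x + e κ)) x κ) (ω (cdiv M (x + e κ)) κ)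
        - γw M ((cmod M (x + e κ) κ : ℤ) : ℝ) • Ad (cornerToBond W M (cdiv M (x + e κ) - e κ) x κ) (ω (cdiv M (x + e κ) - e κ) κ) := by
    unfold hspW
    rw [Ad_sub, Ad_real_smul, Ad_real_smul, hstepA, hstepA]
  rw [hpush]
  by_cases h : cmod M x κ = (M : ℤ) - 1
  · -- face bond: the block index advances, the residue wraps to 0
    have hc := cdiv_add_e_of_eq hM h
    have hm : cmod M (x + e κ) κ = 0 := by
      rw [cmod_add_e_of_eq hM h]; simp [e_apply, h]
    have hr : ((cmod M x κ : ℤ) : ℝ) = (M : ℝ) - 1 := by rw [h]; push_cast; ring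
    simp only [hspW, JmpW, if_pos h, hc, hm, hr, add_sub_cancel_right, Int.cast_zero, αw, γw]
    module
  · -- interior bond: same block, residue + 1
    have hc := cdiv_add_e_of_ne hM h
    have hm : ((cmod M (x + e κ) κ : ℤ) : ℝ) = ((cmod M x κ : ℤ) : ℝ) + 1 := by
      rw [cmod_add_e_of_ne hM h]; simp [e_apply]
    simp only [hspW, JmpW, if_neg h, hc, hm, αw, γw, add_zero]
    module

/-- **THE SPLIT IN `cD` FORM**: `WadWg M (combFrame W M) ω x κ = cD W⁺ κ (hspW M W ω · κ) x + JmpW M W ω x κ` with the shifted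
configuration `W⁺ y μ := W (y + e_κ) μ` — so leaf-03-g6's `NE3CovariantCalculus.sum_hsR_cD` is the covariant summation by parts along `κ`.
[folklore] -/
theorem WadWg_combFrame_eq_cD_add_JmpW (hM : 1 ≤ M) (W : Site d → Fin d → (Matrix n n ℂ)ˣ) (ω : Site d → Fin d → Matrix n n ℂ)
    (x : Site d) (κ : Fin d) :
    WadWg M (combFrame W M) ω x κ = cD (fun y μ => W (y + e κ) μ) κ (fun y => hspW M W ω y κ) x + JmpW M W ω x κ := by
  rw [WadWg_combFrame_eq_split hM]
  rfl

end Split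

/-! ## §4 Sizes -/

section Sizes

variable {M : ℕ}

/-- **SIZE OF THE COVARIANT SPLINE CORRECTION** (unitary `W`): `‖hspW M W ω x κ‖ ≤ (M²∕2)·(‖ω (cdiv M x) κ‖ + ‖ω (cdiv M x − e_κ) κ‖)`
((70S) `norm_hsp_le` — the transports are isometries). [folklore] -/
theorem norm_hspW_le (hM : 1 ≤ M) {W : Site d → Fin d → (Matrix n n ℂ)ˣ} (hW : IsUnitaryCfg W) (ω : Site d → Fin d → Matrix n n ℂ)
    (x : Site d) (κ : Fin d) :
    ‖hspW M W ω x κ‖ ≤ (M : ℝ) ^ 2 / 2 * (‖ω (cdiv M x) κ‖ + ‖ω (cdiv M x - e κ) κ‖) := by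
  have h0 : (0 : ℝ) ≤ ((cmod M x κ : ℤ) : ℝ) := by exact_mod_cast cmod_nonneg (L := M) hM x κ
  have h1 : ((cmod M x κ : ℤ) : ℝ) ≤ (M : ℝ) - 1 := by
    have := cmod_lt (L := M) hM x κ
    have : (cmod M x κ : ℤ) ≤ (M : ℤ) - 1 := by omega
    exact_mod_cast this
  obtain ⟨ha0, ha⟩ := αw_nonneg_le (M := M) h0 h1
  obtain ⟨hg0, hg⟩ := γw_nonneg_le (M := M) h0 h1
  unfold hspW
  refine (norm_sub_le _ _).trans ?_
  rw [norm_smul, norm_smul, Real.norm_of_nonneg ha0, Real.norm_of_nonneg hg0, norm_Ad_of_unitary (cornerToBond_mem hW M _ x κ),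
    norm_Ad_of_unitary (cornerToBond_mem hW M _ x κ), mul_add]
  exact add_le_add (mul_le_mul_of_nonneg_right ha (norm_nonneg _)) (mul_le_mul_of_nonneg_right hg (norm_nonneg _))

/-- **SIZE OF THE FACE JUMP** (unitary `W`): `‖JmpW M W ω x κ‖ ≤ M²·‖ω (cdiv M x) κ‖`. [folklore] -/
theorem norm_JmpW_le {W : Site d → Fin d → (Matrix n n ℂ)ˣ} (hW : IsUnitaryCfg W) (ω : Site d → Fin d → Matrix n n ℂ)
    (x : Site d) (κ : Fin d) :
    ‖JmpW M W ω x κ‖ ≤ (M : ℝ) ^ 2 * ‖ω (cdiv M x) κ‖ := by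
  unfold JmpW
  split_ifs
  · rw [norm_smul, Real.norm_of_nonneg (by positivity), norm_Ad_of_unitary (cornerToBond_mem hW M _ x κ)]
  · rw [norm_zero]; positivity

end Sizes

/-! ## §5 Flat checks -/

section Flat

variable {M : ℕ}

/-- At the flat configuration the corner-to-bond transports are trivial. [folklore] -/
theorem cornerToBond_flatCfg (M : ℕ) (z x : Site d) (κ : Fin d) : cornerToBond (flatCfg (d := d) (n := n)) M z x κ = 1 := by
  unfold cornerToBond
  have : ∀ (w : List (Letter d)) (y : Site d), hol (flatCfg (d := d) (n := n)) y w = 1 := by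
    intro w
    induction w with
    | nil => intro y; rfl
    | cons l w ih =>
        intro y
        rw [hol_cons, ih]
        unfold stepHol MinimalActionWitness.flatCfg
        split_ifs <;> simp
  rw [this, inv_one]

/-- `hspW` at `W = 1` is (70S)'s `hsp`. [folklore] -/
theorem hspW_flatCfg (M : ℕ) (ω : Site d → Fin d → Matrix n n ℂ) (x : Site d) (κ : Fin d) :
    hspW M (flatCfg (d := d) (n := n)) ω x κ = hsp M ω x κ := by
  simp only [hspW, hsp, cornerToBond_flatCfg, Ad_one]

/-- `JmpW` at `W = 1` is (70S)'s `Jmp`. [folklore] -/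
theorem JmpW_flatCfg (M : ℕ) (ω : Site d → Fin d → Matrix n n ℂ) (x : Site d) (κ : Fin d) :
    JmpW M (flatCfg (d := d) (n := n)) ω x κ = Jmp M ω x κ := by
  simp only [JmpW, Jmp, cornerToBond_flatCfg, Ad_one]

end Flat

end

end Summit.QuantumFields.BalabanUV.T4Continuum.NE3CovariantLineAdjoint
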